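import Literature.NumberTheory.Automorphic.LieAlgebraGL
import Literature.NumberTheory.Automorphic.LangQuasiSplit
import HarnessLib

/-!
# The Lie algebra of a subgroup of `GL n k` under a field automorphism: `Lie(σ H) = σ Lie(H)`
(trunk T-AUTOMORPHIC vocabulary of `LieAlgebraGL.lean`; theorems only)

A field automorphism `σ : k ≃+* k` acts entrywise on `GL n k` (the tree's
`glMapEquiv σ : GL n k ≃* GL n k` of `LangQuasiSplit.lean`, i.e. Mathlib's
`Matrix.GeneralLinearGroup.map (σ : k →+* k)`) and on `𝔤𝔩ₙ = Matrix n n k` (`A ↦ A.map σ`, the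
`σ`-semilinear ring automorphism `σ.mapMatrix`).  For a subgroup `H ≤ GL n k` we prove

* `map_mem_lieAlgebraGL_map_iff`: `A.map σ ∈ Lie(σ H) ↔ A ∈ Lie(H)`, and
* `coe_lieAlgebraGL_map`: `Lie(σ H) = σ '' Lie(H)` as subsets of `𝔤𝔩ₙ`

(Borel, *Linear Algebraic Groups*, AG 14.3 / 3.5: `Lie` is compatible with base change by an
automorphism of the ground field; here, concretely: `σ` transports the coordinates `glCoordFun`,
the vanishing ideal — `map_mem_vanishingIdeal_map` — and the differentials at `1`,
`tangentDeriv_map_map : d(σp)_1(σ A) = σ (dp_1 A)`).  This is the invariance of the Lie algebra of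
the image of a Galois representation under `Gal(ℚ̄_ℓ/ℚ_ℓ)` acting on the coefficients.  Since
`A ↦ A.map σ` is only `σ`-semilinear, `Lie(σ H)` is not the image of `Lie(H)` under a `k`-linear
map; the numerical invariants (dimension, rank, dimension of the centre) are nevertheless preserved
(`Literature.Algebra.Lie.RankInvariance`).

Tree search: uses `lieAlgebraGL`, `mem_lieAlgebraGL_iff`, `tangentDeriv`, `tangentDeriv_C/add/mul_X`,
`tangentCoord`, `glCoordFun` (`LieAlgebraGL.lean`, `LinearAlgebraicGroups.lean`),
`mem_vanishingIdeal_glCoordFun_iff` (`IdentityComponent.lean`), and the entrywise action of field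
endomorphisms already in `LangQuasiSplit.lean` (`glMapEquiv`, `glCoordFun_map_eq_comp`,
`eval_glCoordFun_map`, `IsZariskiAut.map_map_symm`, used there for zero loci and Frobenius), plus
Mathlib's `AddMonoidHom.map_trace`, `MvPolynomial.map`; nothing about field automorphisms acting
on `lieAlgebraGL` was in the tree.

## References

* A. Borel, *Linear Algebraic Groups*, 2nd ed. (1991), AG §14, §3.5.
-/

open MvPolynomial

namespace Literature.NumberTheory.Automorphic

variable {k : Type*} [Field k] {n : Type*} [Fintype n] [DecidableEq n]

/-! ### `σ` on `GL n k`, on coordinates and on tangent coordinates -/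

omit [Fintype n] [DecidableEq n] in
/-- `σ⁻¹ (σ A) = A` on matrices. [folklore] -/
theorem matrix_map_map_symm (σ : k ≃+* k) (A : Matrix n n k) : (A.map σ).map σ.symm = A := by
  ext i j; simp

/-- `σ⁻¹ (σ H) = H` for the entrywise action on subgroups of `GL n k`
(`IsZariskiAut.map_map_symm` for the tree's `glMapEquiv σ`, whose underlying homomorphism is
`Matrix.GeneralLinearGroup.map σ`). [folklore] -/
theorem subgroup_map_map_symm (σ : k ≃+* k) (H : Subgroup (GL n k)) :
    (H.map (Matrix.GeneralLinearGroup.map (σ : k →+* k))).map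
      (Matrix.GeneralLinearGroup.map (σ.symm : k →+* k)) = H :=
  IsZariskiAut.map_map_symm (e := glMapEquiv (n := n) σ) H

/-- The coordinates of `1 = σ 1` are fixed by `σ`. [folklore] -/
theorem comp_glCoordFun_one (σ : k ≃+* k) :
    (σ : k →+* k) ∘ glCoordFun (1 : GL n k) = glCoordFun (1 : GL n k) := by
  rw [← glCoordFun_map_eq_comp (σ : k →+* k) 1, map_one]

omit [DecidableEq n] in
/-- **`σ` transports tangent coordinates**: `tangentCoord (σ A) = σ ∘ tangentCoord A` (entries, and
`-tr (σ A) = σ (-tr A)`). [folklore] -/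
theorem tangentCoord_map (σ : k ≃+* k) (A : Matrix n n k) :
    tangentCoord (A.map σ) = σ ∘ tangentCoord A := by
  funext c
  rcases c with ⟨i, j⟩ | u
  · simp [tangentCoord]
  · simp only [tangentCoord, Sum.elim_inr, Function.comp_apply, map_neg]
    rw [AddMonoidHom.map_trace σ A]

/-! ### Values and differentials of `σ p` -/

/-- `(σ p)(1) = σ (p(1))` on `GL n`. [folklore] -/
theorem eval_one_map (σ : k ≃+* k) (p : MvPolynomial (GLCoord n) k) :
    eval (glCoordFun (1 : GL n k)) (map (σ : k →+* k) p) = σ (eval (glCoordFun (1 : GL n k)) p) := by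
  rw [← RingEquiv.coe_toRingHom, ← eval_glCoordFun_map (σ : k →+* k) 1 p, map_one]

/-- **`σ` transports differentials at `1`**: `d(σ p)_1 (σ A) = σ (dp_1 (A))`. [folklore] -/
theorem tangentDeriv_map_map (σ : k ≃+* k) (p : MvPolynomial (GLCoord n) k) (A : Matrix n n k) :
    tangentDeriv (map (σ : k →+* k) p) (A.map σ) = σ (tangentDeriv p A) := by
  induction p using MvPolynomial.induction_on with
  | C a => rw [map_C, tangentDeriv_C, tangentDeriv_C, map_zero]
  | add p q hp hq => rw [map_add, tangentDeriv_add, tangentDeriv_add, hp, hq, map_add]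
  | mul_X p c hp =>
    rw [map_mul, map_X, tangentDeriv_mul_X, tangentDeriv_mul_X, hp, eval_one_map, tangentCoord_map,
      Function.comp_apply, map_add, map_mul, map_mul]
    congr 2
    exact (congrFun (comp_glCoordFun_one (n := n) σ) c).symm

/-! ### Vanishing ideals and Lie algebras under `σ` -/

/-- **`σ 𝓘(H) ⊆ 𝓘(σ H)`**: if `p` vanishes on `H` then `σ p` vanishes on `σ H`. [folklore] -/
theorem map_mem_vanishingIdeal_map (σ : k ≃+* k) {H : Subgroup (GL n k)}
    {p : MvPolynomial (GLCoord n) k}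
    (hp : p ∈ vanishingIdeal k (glCoordFun '' (H : Set (GL n k)))) :
    map (σ : k →+* k) p ∈ vanishingIdeal k
      (glCoordFun '' ((H.map (Matrix.GeneralLinearGroup.map (σ : k →+* k)) : Subgroup (GL n k)) :
        Set (GL n k))) := by
  refine mem_vanishingIdeal_glCoordFun_iff.2 fun x hx => ?_
  obtain ⟨g, hg, rfl⟩ := Subgroup.mem_map.1 hx
  rw [eval_glCoordFun_map, mem_vanishingIdeal_glCoordFun_iff.1 hp g hg, map_zero]

/-- **`A ∈ Lie(H) ⇒ σ A ∈ Lie(σ H)`.** [folklore] -/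
theorem map_mem_lieAlgebraGL_map (σ : k ≃+* k) {H : Subgroup (GL n k)} {A : Matrix n n k}
    (hA : A ∈ lieAlgebraGL H) :
    A.map σ ∈ lieAlgebraGL (H.map (Matrix.GeneralLinearGroup.map (σ : k →+* k))) := by
  rw [mem_lieAlgebraGL_iff] at hA ⊢
  intro p hp
  -- `σ⁻¹ p ∈ 𝓘(σ⁻¹ σ H) = 𝓘(H)`
  have hp' : map (σ.symm : k →+* k) p ∈ vanishingIdeal k (glCoordFun '' (H : Set (GL n k))) := by
    have h := map_mem_vanishingIdeal_map σ.symm hp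
    rwa [subgroup_map_map_symm] at h
  have h := tangentDeriv_map_map σ (map (σ.symm : k →+* k) p) A
  rw [hA _ hp', map_zero, map_map,
    show (σ : k →+* k).comp (σ.symm : k →+* k) = RingHom.id k from
      RingHom.ext fun c => σ.apply_symm_apply c, MvPolynomial.map_id] at h
  exact h

/-- **`Lie(σ H) = σ Lie(H)`, membership form**: `σ A ∈ Lie(σ H) ↔ A ∈ Lie(H)`.
[cite: Borel1991, §3.5 and AG §14] -/
theorem map_mem_lieAlgebraGL_map_iff (σ : k ≃+* k) {H : Subgroup (GL n k)} {A : Matrix n n k} :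
    A.map σ ∈ lieAlgebraGL (H.map (Matrix.GeneralLinearGroup.map (σ : k →+* k))) ↔ A ∈ lieAlgebraGL H := by
  refine ⟨fun h => ?_, map_mem_lieAlgebraGL_map σ⟩
  have h' := map_mem_lieAlgebraGL_map σ.symm h
  rwa [subgroup_map_map_symm, matrix_map_map_symm] at h'

/-- **`Lie(σ H) = σ Lie(H)`** as subsets of `𝔤𝔩ₙ`. [cite: Borel1991, §3.5 and AG §14] -/
theorem coe_lieAlgebraGL_map (σ : k ≃+* k) (H : Subgroup (GL n k)) :
    (lieAlgebraGL (H.map (Matrix.GeneralLinearGroup.map (σ : k →+* k))) : Set (Matrix n n k)) =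
      (fun A : Matrix n n k => A.map σ) '' (lieAlgebraGL H : Set (Matrix n n k)) := by
  ext A
  constructor
  · intro hA
    refine ⟨A.map σ.symm, ?_, ?_⟩
    · have h := map_mem_lieAlgebraGL_map σ.symm hA
      rwa [subgroup_map_map_symm] at h
    · ext i j; simp
  · rintro ⟨B, hB, rfl⟩
    exact map_mem_lieAlgebraGL_map σ hB

end Literature.NumberTheory.Automorphic
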